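import Literature.Computability.Cryptography.PeriodFindingSums
import HarnessLib

/-!
# Frequency tails of run tables (one-dimensional Dirichlet-kernel bounds)

Topic `Computability/Cryptography` (harmonic analysis of period finding); theorem-only file, no named facts.

A **run table** on `[0, S)` is a table every fibre of which is a union of at most two (disjoint) intervals — a circle cut
into arcs and sampled on a grid, as the one-dimensional cell functions `C_g` of the class-group table of Hallgren's algorithm
(`PeriodFinding.corrMass_shiftCell`). Its autocorrelation mass at a nonzero frequency `k` is a sum of squared Dirichlet
kernels, `≤ #cells · S²/min(k, S−k)²`, so the total mass at frequencies with `min(k, S − k) > K₀` is `≤ 2 · #cells · S²/K₀`: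
out of the total `S²` (`sum_corrMass`), a run table puts only a `2 #cells / K₀` fraction beyond `K₀`, WHATEVER the run lengths.

* `norm_sum_Ico_chr_le` — `‖∑_{i ∈ [a,b)} e(ki/S)‖ ≤ S / (2 min(k, S−k))` for `0 < k < S`;
* `corrMass_runTable_le` — `corrMass S C k ≤ #cells · S² / min(k, S−k)²`;
* `sum_corrMass_runTable_tail_le` — the tail bound.

## References

* P. W. Shor, SIAM J. Comput. 26 (1997), §5 (the `1/sin²` tail of period finding). [Shor1997]
* S. Hallgren, STOC 2005, §4. [Hallgren2005]
-/

noncomputable section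

namespace Literature.Computability.Cryptography

namespace PeriodFinding

open Complex Finset Real

/-! ### Trigonometric bookkeeping -/

/-- For `0 < k < S`: `2 min(k, S − k) / S ≤ sin(π k / S)`. [folklore] -/
theorem two_mul_min_div_le_sin {S k : ℕ} (hk : 0 < k) (hkS : k < S) :
    2 * ((min k (S - k) : ℕ) : ℝ) / S ≤ Real.sin (π * k / S) := by
  have hS : (0 : ℝ) < S := by exact_mod_cast (lt_trans hk hkS)
  rcases le_or_gt (2 * k) S with h | h
  · -- `k ≤ S/2`: Jordan's inequality at `x = π k / S ≤ π / 2`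
    have hmin : ((min k (S - k) : ℕ) : ℝ) = k := by
      rw [min_eq_left (by omega : k ≤ S - k)]
    rw [hmin]
    have hx0 : (0 : ℝ) ≤ π * k / S := by positivity
    have hx1 : π * k / S ≤ π / 2 := by
      rw [div_le_div_iff₀ hS two_pos]
      have : (2 * k : ℝ) ≤ S := by exact_mod_cast h
      nlinarith [Real.pi_pos]
    have hj := Real.mul_le_sin hx0 hx1
    calc 2 * (k : ℝ) / S = 2 / π * (π * k / S) := by field_simp
      _ ≤ Real.sin (π * k / S) := hj
  · -- `k > S/2`: use `sin(π − x) = sin x` with `x = π (S − k)/S`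
    have hmin : ((min k (S - k) : ℕ) : ℝ) = ((S - k : ℕ) : ℝ) := by
      rw [min_eq_right (by omega : S - k ≤ k)]
    rw [hmin]
    have hsub : ((S - k : ℕ) : ℝ) = (S : ℝ) - k := by rw [Nat.cast_sub hkS.le]
    have hx0 : (0 : ℝ) ≤ π * ((S - k : ℕ) : ℝ) / S := by positivity
    have hx1 : π * ((S - k : ℕ) : ℝ) / S ≤ π / 2 := by
      rw [div_le_div_iff₀ hS two_pos, hsub]
      have : (2 * ((S : ℝ) - k)) ≤ S := by
        have : (S : ℝ) < 2 * k := by exact_mod_cast h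
        linarith
      nlinarith [Real.pi_pos]
    have hj := Real.mul_le_sin hx0 hx1
    have heq : Real.sin (π * k / S) = Real.sin (π * ((S - k : ℕ) : ℝ) / S) := by
      rw [hsub, show π * ((S : ℝ) - k) / S = π - π * k / S by field_simp, Real.sin_pi_sub]
    rw [heq]
    calc 2 * (((S - k : ℕ) : ℝ)) / S = 2 / π * (π * ((S - k : ℕ) : ℝ) / S) := by field_simp
      _ ≤ _ := hj

/-- **A block of a geometric progression of characters**: for `0 < k < S`,
`‖∑_{i ∈ [a, b)} chr S k i‖ ≤ S / (2 min(k, S − k))`. [cite: Shor1997, §5] -/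
theorem norm_sum_Ico_chr_le {S k : ℕ} (hk : 0 < k) (hkS : k < S) (a b : ℕ) :
    ‖∑ i ∈ Ico a b, chr S k i‖ ≤ (S : ℝ) / (2 * ((min k (S - k) : ℕ) : ℝ)) := by
  have hS : (0 : ℝ) < S := by exact_mod_cast (lt_trans hk hkS)
  have hmin : (0 : ℝ) < ((min k (S - k) : ℕ) : ℝ) := by
    have : 0 < min k (S - k) := lt_min hk (by omega)
    exact_mod_cast this
  set z : ℂ := cexp (2 * π * I * ((k : ℂ) / S)) with hz
  have hchr : ∀ i : ℕ, chr S k i = z ^ i := by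
    intro i
    rw [chr_def, hz, ← Complex.exp_nat_mul]
    congr 1
    push_cast
    ring
  have hz1 : ‖z‖ = 1 := by
    rw [hz, show 2 * (π : ℂ) * I * ((k : ℂ) / S) = ((2 * π * k / S : ℝ) : ℂ) * I by push_cast; ring]
    exact Complex.norm_exp_ofReal_mul_I _
  -- `‖z − 1‖ = 2 sin(π k / S) > 0`
  have hsinpos : 0 < Real.sin (π * k / S) := by
    apply Real.sin_pos_of_pos_of_lt_pi
    · positivity
    · rw [div_lt_iff₀ hS]
      have : (k : ℝ) < S := by exact_mod_cast hkS
      nlinarith [Real.pi_pos]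
  have hnorm : ‖z - 1‖ = 2 * Real.sin (π * k / S) := by
    rw [hz, show 2 * (π : ℂ) * I * ((k : ℂ) / S) = I * ((2 * π * k / S : ℝ) : ℂ) by push_cast; ring,
      Complex.norm_exp_I_mul_ofReal_sub_one]
    rw [show (2 * π * k / S : ℝ) / 2 = π * k / S by ring, Real.norm_eq_abs, abs_of_pos (mul_pos two_pos hsinpos)]
  have hzne : z ≠ 1 := by
    intro h
    have : ‖z - 1‖ = 0 := by rw [h, sub_self, norm_zero]
    rw [hnorm] at this
    linarith
  -- the block as `z^a · ∑_{j < b − a} z^j`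
  have hblock : ∑ i ∈ Ico a b, chr S k i = z ^ a * ∑ j ∈ range (b - a), z ^ j := by
    rw [sum_Ico_eq_sum_range, mul_sum]
    exact sum_congr rfl fun j _ => by rw [hchr, pow_add]
  rw [hblock, norm_mul, norm_pow, hz1, one_pow, one_mul, geom_sum_eq hzne, norm_div]
  have hnum : ‖z ^ (b - a) - 1‖ ≤ 2 :=
    (norm_sub_le _ _).trans (by rw [norm_pow, hz1, one_pow, norm_one]; norm_num)
  have hle := two_mul_min_div_le_sin hk hkS
  rw [hnorm]
  rw [div_le_div_iff₀ (by positivity) (by positivity)]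
  calc ‖z ^ (b - a) - 1‖ * (2 * ((min k (S - k) : ℕ) : ℝ)) ≤ 2 * (2 * ((min k (S - k) : ℕ) : ℝ)) := by gcongr
    _ = (2 * ((min k (S - k) : ℕ) : ℝ) / S) * (2 * S) := by field_simp
    _ ≤ Real.sin (π * k / S) * (2 * S) := by gcongr
    _ = S * (2 * Real.sin (π * k / S)) := by ring

variable {Ω : Type*} [DecidableEq Ω]

/-- **The autocorrelation mass of a run table at a nonzero frequency**: if every fibre of `C` on `[0, S)` is a disjoint
union of at most two intervals, then `corrMass S C k ≤ #cells · S² / min(k, S − k)²` for `0 < k < S`.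
[cite: Shor1997, §5] -/
theorem corrMass_runTable_le {S : ℕ} (C : ℕ → Ω)
    (hfib : ∀ ω ∈ (range S).image C, ∃ a b a' b' : ℕ, Disjoint (Ico a b) (Ico a' b') ∧
      (range S).filter (fun i => C i = ω) = Ico a b ∪ Ico a' b')
    {k : ℕ} (hk : 0 < k) (hkS : k < S) :
    corrMass S C k ≤ ((range S).image C).card * (S : ℝ) ^ 2 / ((min k (S - k) : ℕ) : ℝ) ^ 2 := by
  have hmin : (0 : ℝ) < ((min k (S - k) : ℕ) : ℝ) := by
    have : 0 < min k (S - k) := lt_min hk (by omega)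
    exact_mod_cast this
  unfold corrMass
  have hterm : ∀ ω ∈ (range S).image C,
      ‖∑ v ∈ (range S).filter (fun v => C v = ω), chr S k v‖ ^ 2 ≤ (S : ℝ) ^ 2 / ((min k (S - k) : ℕ) : ℝ) ^ 2 := by
    intro ω hω
    obtain ⟨a, b, a', b', hdisj, hfibω⟩ := hfib ω hω
    rw [hfibω, sum_union hdisj]
    have h1 := norm_sum_Ico_chr_le hk hkS a b
    have h2 := norm_sum_Ico_chr_le hk hkS a' b'
    have hsum : ‖(∑ i ∈ Ico a b, chr S k i) + ∑ i ∈ Ico a' b', chr S k i‖ ≤ (S : ℝ) / ((min k (S - k) : ℕ) : ℝ) :=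
      (norm_add_le _ _).trans (by
        calc _ ≤ (S : ℝ) / (2 * ((min k (S - k) : ℕ) : ℝ)) + (S : ℝ) / (2 * ((min k (S - k) : ℕ) : ℝ)) := add_le_add h1 h2
          _ = (S : ℝ) / ((min k (S - k) : ℕ) : ℝ) := by field_simp; ring)
    have hnn : 0 ≤ ‖(∑ i ∈ Ico a b, chr S k i) + ∑ i ∈ Ico a' b', chr S k i‖ := norm_nonneg _
    calc _ ≤ ((S : ℝ) / ((min k (S - k) : ℕ) : ℝ)) ^ 2 := pow_le_pow_left₀ hnn hsum 2
      _ = (S : ℝ) ^ 2 / ((min k (S - k) : ℕ) : ℝ) ^ 2 := by rw [div_pow]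
  calc _ ≤ ∑ ω ∈ (range S).image C, (S : ℝ) ^ 2 / ((min k (S - k) : ℕ) : ℝ) ^ 2 := sum_le_sum hterm
    _ = _ := by rw [sum_const, nsmul_eq_mul]; ring

/-- **The frequency tail of a run table**: with fibres unions of at most two intervals and `#cells` values,
`∑_{K₀ < k, K₀ < S − k} corrMass S C k ≤ 2 · #cells · S² / K₀` — out of the total mass `S²` (`sum_corrMass`) only a
`2 #cells / K₀` fraction lies beyond `K₀`, whatever the run lengths. [cite: Shor1997, §5] [cite: Hallgren2005, §4] -/
theorem sum_corrMass_runTable_tail_le {S : ℕ} (C : ℕ → Ω)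
    (hfib : ∀ ω ∈ (range S).image C, ∃ a b a' b' : ℕ, Disjoint (Ico a b) (Ico a' b') ∧
      (range S).filter (fun i => C i = ω) = Ico a b ∪ Ico a' b')
    {K₀ : ℕ} (hK₀ : 1 ≤ K₀) :
    ∑ k ∈ (range S).filter (fun k => K₀ < k ∧ K₀ < S - k), corrMass S C k ≤
      2 * ((range S).image C).card * (S : ℝ) ^ 2 / K₀ := by
  set N : ℝ := (((range S).image C).card : ℝ) with hN
  set T := (range S).filter (fun k => K₀ < k ∧ K₀ < S - k) with hT
  have hmemT : ∀ k ∈ T, K₀ < k ∧ K₀ < S - k ∧ k < S := fun k hk => by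
    have h := mem_filter.1 hk
    exact ⟨h.2.1, h.2.2, mem_range.1 h.1⟩
  -- pointwise: `corrMass ≤ N S² (1/k² + 1/(S−k)²)`
  have hpt : ∀ k ∈ T, corrMass S C k ≤ N * (S : ℝ) ^ 2 * (1 / (k : ℝ) ^ 2 + 1 / ((S - k : ℕ) : ℝ) ^ 2) := by
    intro k hk
    obtain ⟨h1, h2, h3⟩ := hmemT k hk
    have hk0 : 0 < k := by omega
    have hle := corrMass_runTable_le C hfib hk0 h3
    have hkpos : (0 : ℝ) < k := by exact_mod_cast hk0
    have hSk : (0 : ℝ) < ((S - k : ℕ) : ℝ) := by exact_mod_cast (by omega : 0 < S - k)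
    have hmin : (1 : ℝ) / ((min k (S - k) : ℕ) : ℝ) ^ 2 ≤ 1 / (k : ℝ) ^ 2 + 1 / ((S - k : ℕ) : ℝ) ^ 2 := by
      rcases le_total k (S - k) with h | h
      · rw [min_eq_left h]
        have : (0 : ℝ) ≤ 1 / ((S - k : ℕ) : ℝ) ^ 2 := by positivity
        linarith
      · rw [min_eq_right h]
        have : (0 : ℝ) ≤ 1 / (k : ℝ) ^ 2 := by positivity
        linarith
    have hNS : 0 ≤ N * (S : ℝ) ^ 2 := by positivity
    calc corrMass S C k ≤ N * (S : ℝ) ^ 2 / ((min k (S - k) : ℕ) : ℝ) ^ 2 := hle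
      _ = N * (S : ℝ) ^ 2 * (1 / ((min k (S - k) : ℕ) : ℝ) ^ 2) := by ring
      _ ≤ N * (S : ℝ) ^ 2 * (1 / (k : ℝ) ^ 2 + 1 / ((S - k : ℕ) : ℝ) ^ 2) := by gcongr
  -- `∑_{K₀ < k ≤ N} 1/k² ≤ 1/K₀` (telescoping; cf. the same estimate in `NumberTheory/LFunctions/SiegelWalfiszLiouville.lean`)
  have hIoc : ∀ N : ℕ, ∑ k ∈ Ioc K₀ N, (1 : ℝ) / (k : ℝ) ^ 2 ≤ 1 / K₀ := by
    have key : ∀ N : ℕ, K₀ ≤ N → ∑ k ∈ Ioc K₀ N, (1 : ℝ) / (k : ℝ) ^ 2 ≤ 1 / K₀ - 1 / N := by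
      intro N hN
      induction N, hN using Nat.le_induction with
      | base => simp
      | succ N hKN ih =>
        rw [sum_Ioc_succ_top hKN]
        have hN : (0 : ℝ) < N := by exact_mod_cast (lt_of_lt_of_le hK₀ hKN)
        have step : (1 : ℝ) / ((N + 1 : ℕ) : ℝ) ^ 2 ≤ 1 / N - 1 / ((N + 1 : ℕ) : ℝ) := by
          push_cast
          rw [div_sub_div _ _ hN.ne' (by positivity), div_le_div_iff₀ (by positivity) (by positivity)]
          nlinarith
        linarith
    intro N
    rcases le_or_gt K₀ N with h | h
    · exact (key N h).trans (sub_le_self _ (by positivity))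
    · rw [Ioc_eq_empty (by omega), sum_empty]; positivity
  -- the two sums of `1/k²`, the second one reflected by `k ↦ S − k`
  have hsum1 : ∑ k ∈ T, (1 : ℝ) / (k : ℝ) ^ 2 ≤ 1 / K₀ := by
    calc ∑ k ∈ T, (1 : ℝ) / (k : ℝ) ^ 2 ≤ ∑ k ∈ Ioc K₀ S, (1 : ℝ) / (k : ℝ) ^ 2 := by
          apply sum_le_sum_of_subset_of_nonneg
          · intro k hk
            obtain ⟨h1, _, h3⟩ := hmemT k hk
            exact mem_Ioc.2 ⟨h1, h3.le⟩
          · intro k _ _; positivity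
      _ ≤ 1 / K₀ := hIoc S
  have hsum2 : ∑ k ∈ T, (1 : ℝ) / ((S - k : ℕ) : ℝ) ^ 2 = ∑ k ∈ T, (1 : ℝ) / (k : ℝ) ^ 2 := by
    refine sum_nbij' (fun k => S - k) (fun k => S - k) ?_ ?_ ?_ ?_ ?_
    · intro k hk
      obtain ⟨h1, h2, h3⟩ := hmemT k hk
      exact mem_filter.2 ⟨mem_range.2 (by omega), h2, by rw [Nat.sub_sub_self h3.le]; exact h1⟩
    · intro k hk
      obtain ⟨h1, h2, h3⟩ := hmemT k hk
      exact mem_filter.2 ⟨mem_range.2 (by omega), h2, by rw [Nat.sub_sub_self h3.le]; exact h1⟩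
    · intro k hk
      obtain ⟨_, _, h3⟩ := hmemT k hk
      exact Nat.sub_sub_self h3.le
    · intro k hk
      obtain ⟨_, _, h3⟩ := hmemT k hk
      exact Nat.sub_sub_self h3.le
    · intro k hk
      rfl
  calc ∑ k ∈ T, corrMass S C k ≤ ∑ k ∈ T, N * (S : ℝ) ^ 2 * (1 / (k : ℝ) ^ 2 + 1 / ((S - k : ℕ) : ℝ) ^ 2) :=
        sum_le_sum hpt
    _ = N * (S : ℝ) ^ 2 * (∑ k ∈ T, (1 : ℝ) / (k : ℝ) ^ 2 + ∑ k ∈ T, (1 : ℝ) / ((S - k : ℕ) : ℝ) ^ 2) := by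
        rw [← mul_sum, sum_add_distrib]
    _ = N * (S : ℝ) ^ 2 * (2 * ∑ k ∈ T, (1 : ℝ) / (k : ℝ) ^ 2) := by rw [hsum2]; ring
    _ ≤ N * (S : ℝ) ^ 2 * (2 * (1 / K₀)) := by gcongr
    _ = 2 * N * (S : ℝ) ^ 2 / K₀ := by ring

end PeriodFinding

end Literature.Computability.Cryptography
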